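/-
Copyright (c) 2026 the pub-hodgecm-mathlib formalisation cell (harness21).  Prover seat hodgecm-mathlib-LH4-p16 (g2), req620 Track A «(D-RAM) FOUR-FRAME» squad
(STAGE-1b, row (2) of the piece `f_{T₊}`, the (β₂) road (R-36); β₂ sub-dealer LH4-p04 (g9) «= ROAD K5∕K6», target ‹CORE.letter.v1›; MECH-K3 v1 §1 «admissible digits =
sphere ∩ Q-class»: K5-C, eighth file), 2026-09-05.
-/
import Summits.HodgeConjecture.HodgeConjecture.Theorems.F0P3cDyRamRowCellSphereTransport      -- ★ K5-C (6) (this seat): `ncard_fibre_le_ncard_fibre_of_sphere`; brings ★ p863477, ★ p863427, ★ p863246, ★ DEFS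
import Summits.HodgeConjecture.HodgeConjecture.Theorems.F0P3cDyRamThetaNormClassReciprocity   -- ★ p863223 (this seat): `exists_normTheta_of_fixed_normTheta` (the class test from `_c12 ∕ _c13 ∕ _c20`)
import HarnessLib

/-!
# Crux `H413`, line LH4 «(D-RAM) FOUR-FRAME» — STAGE-1b, row (2), the (β₂) road (R-36), (ROW-INT) ∕ ‹CORE›, K5-C (8): «EVERY POINT OF THE CELL'S SPHERE IN THE RIGHT CLASS IS A
# DIGIT OF THE CELL» — realisability of the transport multiplier and non-emptiness of every fibre of the literal's `Q`-class

Cell `hodgecm-mathlib` (D-0151), FLOOR 0, crux item H413 = `stmt-HodgeConjecture-24833`, route of record `HCCMUnconditional`; squad F0∕P3c∕LH4; lane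
`--supports stmt-HodgeConjecture-24833 --as helper` (count-neutral; pays NO tier-0 row).  THEOREMS ONLY (no `def`, no instance, no notation, no `sorry`, default heartbeats);
★-only imports; states NO law; (β₂) stays a HYPOTHESIS.  DATUM-FREE one-field letters as in ★ p863477 ∕ ★ K5-C (6), plus the three lane-C frame letters of ★ p863223 IN SHAPE
(`_c12 : |c₀| = 1`, `_c13` dichotomy, `_c20` witness).
WHY (MECH-K3 v1 §1–§2 `F0/P3c/LH4/LH4-p16/g2/MECH-K3.v1.LH4p16g2.md`).  ★ K5-C (5)∕(6) compare the fibres of a row cell over two digits GIVEN a flip `ε` with `εΘε = ρκ₂∕ρκ₁`; ★ p863427 §4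
shows that multiplier lands exactly on `κ₂`.  THIS FILE supplies `ε`: the multiplier `N = ρκ₂∕ρκ₁` is a `Θ`-fixed unit with `N·ρN = N_ρ(κ₂)∕N_ρ(κ₁)` (§1), so by ★ p863223 it IS a
`Θ`-norm as soon as `N_ρ(κ₂)∕N_ρ(κ₁)` is the `Θ`-norm of a `ρ`-fixed element — «`κ₁, κ₂` in the same `Q`-class» (`exists_flip_of_sameClass`).  Consequently (§2, HEAD
`fibre_nonempty_of_sameClass`): if the cell has ONE vertex with class `P` and digit `κ₁`, then over EVERY point `κ₂` of the sphere `|κ₂| = |κ₁|` in `κ₁`'s `Q`-class the fibre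
(P, κ₂, r) is non-empty for every tolerance `r` — the vertex `ε • Λ₀` sits EXACTLY at `κ₂` (★ K5-C (6) at `r = 0`).  With ★ K5-C (5)∕(6)∕(7) this completes MECH-K3's uniform fibration:
a literal's cell is «(sphere ∩ its `Q`-class) × (uniform fibre) × (one populated half)».
WHAT IS NOT CLAIMED: that digits OUTSIDE the `Q`-class do not occur (they do not: `ω(N_ρ u₀)` is the literal's constant — the converse direction of ★ p863223, one line for the
assembler), any census identity.
HONEST LABEL.  Count-neutral lattice bookkeeping; nothing printed is asserted; no census law is stated; `HC_CM` is proved only modulo the 7 printed citations (2 remaining named inputs: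
hLiu418 = `stmt-HodgeConjecture-24832`, h413 = `stmt-HodgeConjecture-24833`) until rung 0 closes.
## References
* [Jacobowitz1962] R. Jacobowitz, *Hermitian forms over local fields*, Amer. J. Math. 84 (1962): §4.
* [Kottwitz1986BaseChangeUnits] R. E. Kottwitz, *Base change for unit elements of Hecke algebras*, Compositio Math. 60 (1986): §1 pp. 240–241.
* [Serre1979] J.-P. Serre, *Local Fields*, GTM 67 (1979): Ch. XIV §6 (norm groups of the biquadratic frame), Ch. V §3 Cor. 3.
-/

set_option autoImplicit false

noncomputable section

namespace Summit.HodgeConjecture.HodgeConjecture.Cruxes.H413.F0P3cDyRamRowCellDigitRealisability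

open scoped Valued WithZero Pointwise
open WithZero
open Summit.HodgeConjecture.HodgeConjecture.Cruxes.H413.F0P3cDyRamToricCensusDefs
open Summit.HodgeConjecture.HodgeConjecture.Cruxes.H413.F0P3cDyRamRowCellDigitTransport (map_eq_one_sub_of_trace_one v_eq_of_v_sub_lt)
open Summit.HodgeConjecture.HodgeConjecture.Cruxes.H413.F0P3cDyRamRowCellSphereTransport (ncard_fibre_le_ncard_fibre_of_sphere)
open Summit.HodgeConjecture.HodgeConjecture.Cruxes.H413.F0P3cDyRamThetaNormClassReciprocity (exists_normTheta_of_fixed_normTheta)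

variable {K : Type} [Field K] [Valued K ℤᵐ⁰] {ρ Θ : K →+* K} {α : K}

/-! ## §1 The multiplier is a `Θ`-fixed unit whose `ρ`-norm is the ratio of the two `Q`-values -/

/-- **LETTERS OF THE MULTIPLIER `N = ρκ₂∕ρκ₁`**: `ΘN = N` (`Θρ = ρΘ`, `κᵢ` `Θ`-fixed), `|N| = 1` (`|κ₂| = |κ₁| ≠ 0`), `N·ρN = (κ₂ρκ₂)∕(κ₁ρκ₁)` (`ρ² = 1`).
[cite: Serre1979, Ch. XIV §6] -/
theorem transportMul_letters (hρρ : ∀ x, ρ (ρ x) = x) (hvρ : ∀ x, Valued.v (ρ x) = Valued.v x) (hΘρ : ∀ x, Θ (ρ x) = ρ (Θ x))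
    {κ₁ κ₂ : K} (hΘκ₁ : Θ κ₁ = κ₁) (hΘκ₂ : Θ κ₂ = κ₂) (hκ₁0 : κ₁ ≠ 0) (hκ₂v : Valued.v κ₂ = Valued.v κ₁) :
    Θ (ρ κ₂ / ρ κ₁) = ρ κ₂ / ρ κ₁ ∧ Valued.v (ρ κ₂ / ρ κ₁) = 1 ∧ ρ κ₂ / ρ κ₁ * ρ (ρ κ₂ / ρ κ₁) = (κ₂ * ρ κ₂) / (κ₁ * ρ κ₁) := by
  refine ⟨by rw [map_div₀, hΘρ, hΘρ, hΘκ₁, hΘκ₂], ?_, ?_⟩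
  · rw [map_div₀, hvρ, hvρ, hκ₂v, div_self ((Valuation.ne_zero_iff _).2 hκ₁0)]
  · rw [map_div₀, hρρ, hρρ, div_mul_div_comm, mul_comm (ρ κ₂) κ₂, mul_comm (ρ κ₁) κ₁]

/-- **THE FLIP EXISTS IN THE SAME `Q`-CLASS.**  Frame letters `_c12 ∕ _c13 ∕ _c20` (★ p863223's shape), `κ₁, κ₂` `Θ`-fixed with `|κ₂| = |κ₁| ≠ 0`, and the class condition
«`N_ρ(κ₂)∕N_ρ(κ₁) = eΘe` with `ρe = e`» ⟹ `∃ ε, εΘε = ρκ₂∕ρκ₁`. [cite: Serre1979, Ch. XIV §6] [cite: Kottwitz1986BaseChangeUnits, §1 pp. 240–241] -/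
theorem exists_flip_of_sameClass (hρρ : ∀ x, ρ (ρ x) = x) (hvρ : ∀ x, Valued.v (ρ x) = Valued.v x) (hΘρ : ∀ x, Θ (ρ x) = ρ (Θ x))
    {c₀ : K} (hc₀1 : Valued.v c₀ = 1)
    (hdich : ∀ x : K, Θ x = x → Valued.v x = 1 → (∃ z : K, z * Θ z = x) ∨ ∃ z : K, z * Θ z = c₀ * x)
    (hwit : ∃ a : K, Θ a = a ∧ Valued.v a = 1 ∧ ¬ ∃ e : K, ρ e = e ∧ e * Θ e = a * ρ a)
    {κ₁ κ₂ : K} (hΘκ₁ : Θ κ₁ = κ₁) (hΘκ₂ : Θ κ₂ = κ₂) (hκ₁0 : κ₁ ≠ 0) (hκ₂v : Valued.v κ₂ = Valued.v κ₁)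
    (hQ : ∃ e : K, ρ e = e ∧ e * Θ e = (κ₂ * ρ κ₂) / (κ₁ * ρ κ₁)) :
    ∃ ε : K, ε * Θ ε = ρ κ₂ / ρ κ₁ := by
  obtain ⟨hΘN, hN1, hNN⟩ := transportMul_letters hρρ hvρ hΘρ hΘκ₁ hΘκ₂ hκ₁0 hκ₂v
  exact exists_normTheta_of_fixed_normTheta hρρ hΘρ hc₀1 hdich hwit hΘN hN1 (by rw [hNN]; exact hQ)

/-! ## §2 HEAD — every sphere point in the class is realised -/

/-- **HEAD — «EVERY POINT OF THE CELL'S SPHERE IN THE RIGHT CLASS IS A DIGIT OF THE CELL».**  ★ p863477's letters for the cell `(j, a)` (`1 ≤ a`, `|μ| ≤ (|ϖE|^a)²`, `|ϖE| < 1`, `hFgap`),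
the lane-C frame letters `_c12 ∕ _c13 ∕ _c20`, ONE vertex `Λ₀` of the cell (generator `x₀`, five clauses + depth) with population class `P` and digit
`κ₁ := ρ(h x₀Θx₀)∕Tr_ρ(h x₀Θx₀)`, and a `Θ`-fixed point `κ₂` of the line on the same sphere (`|κ₂| = |κ₁|`) in the same `Q`-class ⟹ for every tolerance `r` the fibre (P, κ₂, r) is
NON-EMPTY (★ K5-C (6) at tolerance `0`: the transported vertex sits exactly at `κ₂`). [cite: Kottwitz1986BaseChangeUnits, §1 pp. 240–241] [cite: Jacobowitz1962, §4] [cite: Serre1979, Ch. XIV §6] -/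
theorem fibre_nonempty_of_sameClass (hρρ : ∀ x, ρ (ρ x) = x) (hvρ : ∀ x, Valued.v (ρ x) = Valued.v x) (hΘΘ : ∀ x, Θ (Θ x) = x)
    (hΘρ : ∀ x, Θ (ρ x) = ρ (Θ x))
    {h ϖE μ : K} (hΘh : Θ h = h) (hρϖ : ρ ϖE = ϖE) (hϖ0 : ϖE ≠ 0) (hϖlt : Valued.v ϖE < 1) {j a : ℕ} (ha1 : 1 ≤ a)
    (hcc : ϖE ^ j * (α - ρ α) ≠ 0)
    (hμ : Valued.v μ ≤ (Valued.v ϖE ^ a) ^ 2)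
    (hFgap : ∀ z : K, ρ z = z → Θ z = z → Valued.v ϖE < Valued.v z → Valued.v z ≤ 1 → Valued.v z = 1)
    {c₀ : K} (hc₀1 : Valued.v c₀ = 1)
    (hdich : ∀ x : K, Θ x = x → Valued.v x = 1 → (∃ z : K, z * Θ z = x) ∨ ∃ z : K, z * Θ z = c₀ * x)
    (hwit : ∃ a : K, Θ a = a ∧ Valued.v a = 1 ∧ ¬ ∃ e : K, ρ e = e ∧ e * Θ e = a * ρ a)
    {Λ₀ : AddSubgroup K} {x₀ : K} (hx₀ : x₀ ≠ 0) (hmem : ∀ x, x ∈ Λ₀ ↔ ∃ ζ, IsOrd ρ α (ϖE ^ j) ζ ∧ x = x₀ * ζ)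
    (hyO : IsOrd ρ α (ϖE ^ j) (dualGen ρ Θ α (ϖE ^ j) h x₀)) (hyprim : ¬ IsOrd ρ α (ϖE ^ j) (dualGen ρ Θ α (ϖE ^ j) h x₀ / ϖE))
    (hylev : Valued.v (dualGen ρ Θ α (ϖE ^ j) h x₀) = Valued.v ϖE ^ a) (hdep : IsOrd ρ α (ϖE ^ j) (μ / dualGen ρ Θ α (ϖE ^ j) h x₀))
    (P : Prop) (hP : (∃ c : K, ρ c = c ∧ c * Θ c = h * (x₀ * Θ x₀) + ρ (h * (x₀ * Θ x₀))) ↔ P)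
    {κ₂ : K} (hκ₂ : κ₂ + ρ κ₂ = 1) (hΘκ₂ : Θ κ₂ = κ₂)
    (hκ₂v : Valued.v κ₂ = Valued.v (ρ (h * (x₀ * Θ x₀)) / (h * (x₀ * Θ x₀) + ρ (h * (x₀ * Θ x₀)))))
    (hQ : ∃ e : K, ρ e = e ∧ e * Θ e = (κ₂ * ρ κ₂) /
      (ρ (h * (x₀ * Θ x₀)) / (h * (x₀ * Θ x₀) + ρ (h * (x₀ * Θ x₀))) * ρ (ρ (h * (x₀ * Θ x₀)) / (h * (x₀ * Θ x₀) + ρ (h * (x₀ * Θ x₀))))))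
    (hfin : (levelSet ρ Θ α ϖE h j a).Finite) (r : ℤᵐ⁰) :
    {Λ : AddSubgroup K | ∃ x₀ : K, x₀ ≠ 0 ∧ (∀ x, x ∈ Λ ↔ ∃ ζ, IsOrd ρ α (ϖE ^ j) ζ ∧ x = x₀ * ζ) ∧
        IsOrd ρ α (ϖE ^ j) (dualGen ρ Θ α (ϖE ^ j) h x₀) ∧ ¬ IsOrd ρ α (ϖE ^ j) (dualGen ρ Θ α (ϖE ^ j) h x₀ / ϖE) ∧
        Valued.v (dualGen ρ Θ α (ϖE ^ j) h x₀) = Valued.v ϖE ^ a ∧ IsOrd ρ α (ϖE ^ j) (μ / dualGen ρ Θ α (ϖE ^ j) h x₀) ∧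
        ((∃ c : K, ρ c = c ∧ c * Θ c = h * (x₀ * Θ x₀) + ρ (h * (x₀ * Θ x₀))) ↔ P) ∧
        Valued.v (ρ (h * (x₀ * Θ x₀)) / (h * (x₀ * Θ x₀) + ρ (h * (x₀ * Θ x₀))) - κ₂) ≤ r}.Nonempty := by
  classical
  -- the old vertex's letters
  obtain ⟨hρt, hΘt, ht1⟩ := F0P3cDyRamRowCellFibreTransport.trace_letters (α := α) hρρ hΘΘ hΘρ hΘh hρϖ hϖ0 hϖlt.le ha1 hcc hFgap hyO hyprim hylev
  set u₀ : K := h * (x₀ * Θ x₀) with hu₀def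
  set t : K := u₀ + ρ u₀ with htdef
  set κ₁ : K := ρ u₀ / t with hκ₁def
  have ht0 : t ≠ 0 := fun h0 => by rw [h0, map_zero] at ht1; exact zero_ne_one ht1
  have hΘu : Θ u₀ = u₀ := by rw [hu₀def, map_mul, map_mul, hΘh, hΘΘ]; ring
  have hκ₁tr : κ₁ + ρ κ₁ = 1 := by rw [hκ₁def, map_div₀, hρρ, hρt, ← add_div, htdef, add_comm, div_self ht0]
  have hΘκ₁ : Θ κ₁ = κ₁ := by rw [hκ₁def, map_div₀, hΘρ, hΘu, hΘt]
  have hY : dualGen ρ Θ α (ϖE ^ j) h x₀ = u₀ * (ϖE ^ j * (α - ρ α)) := by rw [dualGen_def]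
  have hu₀0 : u₀ ≠ 0 := fun h0 => by
    rw [hY, h0, zero_mul, Valuation.map_zero] at hylev
    exact pow_ne_zero _ ((Valuation.ne_zero_iff _).2 hϖ0) hylev.symm
  have hκ₁0 : κ₁ ≠ 0 := by rw [hκ₁def]; exact div_ne_zero ((map_ne_zero ρ).2 hu₀0) ht0
  have hR : Valued.v κ₁ * Valued.v (ϖE ^ j * (α - ρ α)) = Valued.v ϖE ^ a := by
    rw [hκ₁def, map_div₀, hvρ, ht1, div_one, ← Valuation.map_mul, ← hY, hylev]
  -- the flip exists
  obtain ⟨ε, hε⟩ := exists_flip_of_sameClass hρρ hvρ hΘρ hc₀1 hdich hwit hΘκ₁ hΘκ₂ hκ₁0 hκ₂v hQ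
  -- ★ K5-C (6) at tolerance `0`, trivial `hdeep` at depth `0`
  have hdeep0 : ∀ u : K, ρ u = u → Θ u = u → Valued.v (u - 1) ≤ 0 → ∃ c : K, ρ c = c ∧ c * Θ c = u := by
    intro u _ _ hu
    have hu1 : u = 1 := by rwa [le_zero_iff, Valuation.zero_iff, sub_eq_zero] at hu
    exact ⟨1, map_one ρ, by rw [map_one, one_mul, hu1]⟩
  have hle := ncard_fibre_le_ncard_fibre_of_sphere (α := α) (μ := μ) hρρ hvρ hΘΘ hΘρ hΘh hρϖ hϖ0 hϖlt ha1 hcc hμ hFgap hdeep0 hκ₁tr hκ₂ hΘκ₁ hΘκ₂ hR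
    hκ₂v (r := 0) (zero_lt_iff.2 ((Valuation.ne_zero_iff _).2 hκ₁0)) (by rw [mul_zero]; exact zero_le) hε P hfin
  -- the source fibre contains `Λ₀`
  have hfin₂ : {Λ : AddSubgroup K | ∃ x₀ : K, x₀ ≠ 0 ∧ (∀ x, x ∈ Λ ↔ ∃ ζ, IsOrd ρ α (ϖE ^ j) ζ ∧ x = x₀ * ζ) ∧
        IsOrd ρ α (ϖE ^ j) (dualGen ρ Θ α (ϖE ^ j) h x₀) ∧ ¬ IsOrd ρ α (ϖE ^ j) (dualGen ρ Θ α (ϖE ^ j) h x₀ / ϖE) ∧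
        Valued.v (dualGen ρ Θ α (ϖE ^ j) h x₀) = Valued.v ϖE ^ a ∧ IsOrd ρ α (ϖE ^ j) (μ / dualGen ρ Θ α (ϖE ^ j) h x₀) ∧
        ((∃ c : K, ρ c = c ∧ c * Θ c = h * (x₀ * Θ x₀) + ρ (h * (x₀ * Θ x₀))) ↔ P) ∧
        Valued.v (ρ (h * (x₀ * Θ x₀)) / (h * (x₀ * Θ x₀) + ρ (h * (x₀ * Θ x₀))) - κ₂) ≤ 0}.Finite :=
    hfin.subset fun Λ ⟨x₁, hx₁, hmem₁, hyO₁, hyprim₁, hylev₁, _, _, _⟩ => ⟨x₁, hx₁, hmem₁, hyO₁, hyprim₁, hylev₁⟩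
  have hpos : 0 < {Λ : AddSubgroup K | ∃ x₀ : K, x₀ ≠ 0 ∧ (∀ x, x ∈ Λ ↔ ∃ ζ, IsOrd ρ α (ϖE ^ j) ζ ∧ x = x₀ * ζ) ∧
        IsOrd ρ α (ϖE ^ j) (dualGen ρ Θ α (ϖE ^ j) h x₀) ∧ ¬ IsOrd ρ α (ϖE ^ j) (dualGen ρ Θ α (ϖE ^ j) h x₀ / ϖE) ∧
        Valued.v (dualGen ρ Θ α (ϖE ^ j) h x₀) = Valued.v ϖE ^ a ∧ IsOrd ρ α (ϖE ^ j) (μ / dualGen ρ Θ α (ϖE ^ j) h x₀) ∧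
        ((∃ c : K, ρ c = c ∧ c * Θ c = h * (x₀ * Θ x₀) + ρ (h * (x₀ * Θ x₀))) ↔ P) ∧
        Valued.v (ρ (h * (x₀ * Θ x₀)) / (h * (x₀ * Θ x₀) + ρ (h * (x₀ * Θ x₀))) - κ₁) ≤ 0}.ncard := by
    refine (Set.ncard_pos ?_).2 ⟨Λ₀, x₀, hx₀, hmem, hyO, hyprim, hylev, hdep, hP, by rw [sub_self, Valuation.map_zero]⟩
    exact hfin.subset fun Λ ⟨x₁, hx₁, hmem₁, hyO₁, hyprim₁, hylev₁, _, _, _⟩ => ⟨x₁, hx₁, hmem₁, hyO₁, hyprim₁, hylev₁⟩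
  obtain ⟨Λ, hΛ⟩ := (Set.ncard_pos hfin₂).1 (lt_of_lt_of_le hpos hle)
  obtain ⟨x₁, hx₁, hmem₁, hyO₁, hyprim₁, hylev₁, hdep₁, hcls₁, hdig₁⟩ := hΛ
  exact ⟨Λ, x₁, hx₁, hmem₁, hyO₁, hyprim₁, hylev₁, hdep₁, hcls₁, hdig₁.trans zero_le⟩

end Summit.HodgeConjecture.HodgeConjecture.Cruxes.H413.F0P3cDyRamRowCellDigitRealisability

end
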